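import Literature.Probability.RandomPlanarGeometry.HexSAWBrickWallStripFugacityWidthOneComplexTwoTerm
import Literature.Probability.RandomPlanarGeometry.HexSAWBrickWallStripFugacityWidthOneComplexRootGap
import Literature.Analysis.Asymptotics.LinearRecurrenceGrowthBound
import HarnessLib

/-!
# The strip partition function off the real axis: `‖Δ(ye^{iu})·C_{1,2M+c}(ye^{iu}, z)‖ ≤ K(M+1)²·ρ(u)^M`, `ρ(u) = max(s − c(1−cos u)², √(yz))`

Topic `Literature/Probability/RandomPlanarGeometry` (assembles `…WidthOneComplexTwoTerm.lean` — the polynomial trick `exists_coeff_polynomials`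
(`Δ(w)C_{1,N+2}(w,z) = u_{N+2}(w) + e_{N+2}(w)` with both recurrences, for EVERY `w`), the disc bounds and `norm_le_of_rec_eight_sq_complex` —,
`…WidthOneComplexRootGap.lean` (`exists_norm_root_le_sub_gap`: all transfer roots at fugacity `ye^{iu}` have modulus `≤ s − c(1 − cos u)²`) and
`Literature/Analysis/Asymptotics/LinearRecurrenceGrowthBound.lean` (`norm_le_of_rec_three_all_roots`)).  The second input of the LOCAL limit theorem
for the contact number (DOOR-ap5-g28 item 1): away from `u ∈ 2πℤ` the partition function at fugacity `ye^{iu}` is exponentially smaller than `s^{N/2}`,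
UNIFORMLY — here with the partial-fraction denominator `Δ(w) = ((w − z)² + 2w + 2z + 1)²` kept on the left (it vanishes on the circle `‖w‖ = y` exactly
when `y = z + 1`, at `w = z − 1 ± 2i√z`).

* ★★ `exists_norm_mul_stripZ₂C_le_offaxis` — for every parity `c`: `∃ c₀ > 0, K ≥ 0` with
  `‖Δ(ye^{iu})·C_{1,2M+c}(ye^{iu}, z)‖ ≤ K·(M+1)²·max(s − c₀(1 − cos u)², √(yz))^M` for ALL real `u` and ALL `M`.
* ★★ `exists_norm_mul_stripZ₂C_le_of_cos_le` — hence on `cos u ≤ cos δ` (`0 < δ`): `≤ K(M+1)²ρ^M` with ONE `ρ < s`.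
* `norm_twoWallDelta_ge` — `‖Δ(w)‖ ≥ (y − z − 1)⁴` on `‖w‖ = y`; ★★ `exists_norm_stripZ₂C_le_of_cos_le` — for `y ≠ z + 1` the partition function
  ITSELF decays: `‖C_{1,2M+c}(ye^{iu},z)‖ ≤ K(M+1)²ρ^M` on `cos u ≤ cos δ`, `ρ < s`.

## Sources
R. Durrett, *Probability: Theory and Examples* (2019) §3.5 (local limit theorems: the estimate `|φ| ≤ η < 1` off the lattice); R. P. Stanley, EC1 §4.1
Theorem 4.1.1 (iii); N. R. Beaton et al., CMP 326 (2014), arXiv:1109.0358v5 §3.2 Proposition 6.  Lane statements (lane «pcv-sawmu», a-p5 g28); nothing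
is quoted AS PRINTED.
-/

noncomputable section

open Complex Finset
open Literature.Analysis.Asymptotics
open Literature.Probability.LatticeModels Literature.Probability.Percolation

namespace Literature.Probability.RandomPlanarGeometry.SAW.HexBW

namespace WidthOneYZ

variable {y z : ℝ}

/-- ★★ **THE PARTITION FUNCTION OFF THE REAL AXIS.**  For `y, z > 0` and every parity `c` there are `c₀ > 0` and `K ≥ 0` such that for EVERY real
`u` and EVERY `M`, with `w = ye^{iu}` and `s = μ₁(y,z)²`:
`‖((w − z)² + 2w + 2z + 1)²·C_{1,2M+c}(w, z)‖ ≤ K·(M+1)²·(max (s − c₀(1 − cos u)²) √(yz))^M`.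
(`u`-part: the parity subsequence obeys the cubic recurrence whose roots ALL have modulus `≤ s − c₀(1 − cos u)²` — `exists_norm_root_le_sub_gap` — so
`norm_le_of_rec_three_all_roots` applies with data bounded on the disc `‖w‖ ≤ y`; `e`-part: `norm_le_of_rec_eight_sq_complex` with `‖ω‖ = yz`.)
[cite: Durrett2019, §3.5 Theorem 3.5.2 (lane statement: the off-lattice decay for a transfer-matrix statistic); Stanley2012EC1, §4.1 Theorem 4.1.1 (iii)] -/
theorem exists_norm_mul_stripZ₂C_le_offaxis (hy : 0 < y) (hz : 0 < z) (c : ℕ) :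
    ∃ c₀ K : ℝ, 0 < c₀ ∧ 0 ≤ K ∧ ∀ u : ℝ, ∀ M : ℕ,
      ‖(((y : ℂ) * cexp ((u : ℂ) * I) - z) ^ 2 + 2 * ((y : ℂ) * cexp ((u : ℂ) * I)) + 2 * z + 1) ^ 2
          * stripZ₂C 1 (2 * M + c) ((y : ℂ) * cexp ((u : ℂ) * I)) (z : ℂ)‖
        ≤ K * ((M : ℝ) + 1) ^ 2 * (max (stripMuY₂ 1 y z ^ 2 - c₀ * (1 - Real.cos u) ^ 2) (Real.sqrt (y * z))) ^ M := by
  obtain ⟨c₀, hc₀, hgap⟩ := exists_norm_root_le_sub_gap hy hz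
  obtain ⟨P, Q, HPQ⟩ := exists_coeff_polynomials (z : ℂ)
  set s := stripMuY₂ 1 y z ^ 2 with hs
  have hyz0 : 0 < y * z := mul_pos hy hz
  set Θe := Real.sqrt (y * z) with hΘe
  have hΘe0 : 0 < Θe := Real.sqrt_pos.2 hyz0
  set η := Real.sqrt Θe with hη
  have hη0 : 0 < η := Real.sqrt_pos.2 hΘe0
  have hη2 : η ^ 2 = Θe := Real.sq_sqrt hΘe0.le
  -- data bounds on the disc `‖w‖ ≤ y`
  obtain ⟨B₀, hB₀0, hB₀⟩ := exists_norm_eval_le_of_norm_le (P (2 * 0 + c)) y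
  obtain ⟨B₁, hB₁0, hB₁⟩ := exists_norm_eval_le_of_norm_le (P (2 * 1 + c)) y
  obtain ⟨B₂, hB₂0, hB₂⟩ := exists_norm_eval_le_of_norm_le (P (2 * 2 + c)) y
  obtain ⟨Be, hBe0, hBe⟩ : ∃ Be : ℝ, 0 ≤ Be ∧ ∀ j ∈ Finset.range 8, ∀ w : ℂ, ‖w‖ ≤ y → ‖(Q j).eval w‖ ≤ Be := by
    choose B hB0 hB using fun j => exists_norm_eval_le_of_norm_le (Q j) y
    exact ⟨∑ j ∈ Finset.range 8, B j, Finset.sum_nonneg fun j _ => hB0 j,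
      fun j hj w hw => (hB j w hw).trans (Finset.single_le_sum (fun i _ => hB0 i) hj)⟩
  set PΔ : Polynomial ℂ := ((Polynomial.X - Polynomial.C (z : ℂ)) ^ 2 + 2 * Polynomial.X + 2 * Polynomial.C (z : ℂ) + 1) ^ 2 with hPΔ
  have hPΔe : ∀ w : ℂ, PΔ.eval w = ((w - z) ^ 2 + 2 * w + 2 * z + 1) ^ 2 := by intro w; simp [hPΔ]
  obtain ⟨BΔ, hBΔ0, hBΔ⟩ := exists_norm_eval_le_of_norm_le PΔ y
  -- constants
  set Ku : ℝ := 2 * B₀ + 2 * B₁ / Θe + B₂ / Θe ^ 2 with hKu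
  have hKu0 : 0 ≤ Ku := by rw [hKu]; positivity
  set Ke : ℝ := ((c : ℝ) + 2) * η ^ c * ∑ j ∈ Finset.range 4, (Be + Be / (y * z)) / η ^ j with hKe
  have hKe0 : 0 ≤ Ke := by rw [hKe]; exact mul_nonneg (by positivity) (Finset.sum_nonneg fun j _ => by positivity)
  set K : ℝ := Ku + Ke + BΔ * stripZ₂ 1 c y z with hK
  have hK0 : 0 ≤ K := by rw [hK]; have := stripZ₂_pos 1 c hy hz; positivity
  clear_value Ku Ke K
  refine ⟨c₀, K, hc₀, hK0, fun u M => ?_⟩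
  -- fix `u`
  set w : ℂ := (y : ℂ) * cexp ((u : ℂ) * I) with hw
  obtain ⟨hwn, -⟩ := norm_ofReal_mul_cexp_sub_le y u
  rw [← hw, abs_of_pos hy] at hwn
  have hwle : ‖w‖ ≤ y := hwn.le
  set R : ℝ := max (s - c₀ * (1 - Real.cos u) ^ 2) Θe with hR
  have hΘeR : Θe ≤ R := le_max_right _ _
  have hR0 : 0 < R := lt_of_lt_of_le hΘe0 hΘeR
  obtain ⟨Hdec, Hu, He⟩ := HPQ w
  clear_value w
  -- the `u`-part: all roots of the parity cubic have modulus ≤ R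
  have hcubic : ∀ τ : ℂ, twoWallCubic y z τ u = τ ^ 3 - (w + z) * τ ^ 2 - (-(w * (z : ℂ))) * τ - w * (z : ℂ) := by
    intro τ; unfold twoWallCubic; rw [hw]; ring
  have hroots : ∀ τ : ℂ, τ ^ 3 - (w + z) * τ ^ 2 - (-(w * (z : ℂ))) * τ - w * (z : ℂ) = 0 → ‖τ‖ ≤ R := by
    intro τ hτ
    have hF : twoWallCubic y z τ u = 0 := by rw [hcubic]; exact hτ
    exact (hgap u τ hF).trans (le_max_left _ _)
  have hub : ‖(P (2 * M + c)).eval w‖ ≤ Ku * ((M : ℝ) + 1) ^ 2 * R ^ M := by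
    have hrec : ∀ n : ℕ, (P (2 * (n + 3) + c)).eval w
        = (w + z) * (P (2 * (n + 2) + c)).eval w + (-(w * (z : ℂ))) * (P (2 * (n + 1) + c)).eval w + w * (z : ℂ) * (P (2 * n + c)).eval w :=
      fun n => parity_rec_three (e := fun m => (P m).eval w) Hu c n
    have h := norm_le_of_rec_three_all_roots hR0 hroots (fun m => (P (2 * m + c)).eval w) (fun n => hrec n) M
    refine h.trans ?_
    have hb0 : ‖(P (2 * 0 + c)).eval w‖ ≤ B₀ := hB₀ w hwle
    have hb1 : ‖(P (2 * 1 + c)).eval w‖ ≤ B₁ := hB₁ w hwle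
    have hb2 : ‖(P (2 * 2 + c)).eval w‖ ≤ B₂ := hB₂ w hwle
    have hdata : 2 * ‖(P (2 * 0 + c)).eval w‖ + 2 * ‖(P (2 * 1 + c)).eval w‖ / R + ‖(P (2 * 2 + c)).eval w‖ / R ^ 2 ≤ Ku := by
      rw [hKu]
      have h1 : 2 * ‖(P (2 * 1 + c)).eval w‖ / R ≤ 2 * B₁ / Θe := by
        rw [div_le_div_iff₀ hR0 hΘe0]
        have := mul_le_mul hb1 hΘeR hΘe0.le hB₁0
        nlinarith only [this, norm_nonneg ((P (2 * 1 + c)).eval w)]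
      have h2 : ‖(P (2 * 2 + c)).eval w‖ / R ^ 2 ≤ B₂ / Θe ^ 2 := by
        have hR2 : Θe ^ 2 ≤ R ^ 2 := pow_le_pow_left₀ hΘe0.le hΘeR 2
        rw [div_le_div_iff₀ (by positivity) (by positivity)]
        have := mul_le_mul hb2 hR2 (pow_pos hΘe0 2).le hB₂0
        linarith only [this]
      linarith only [hb0, h1, h2]
    calc ((M : ℝ) + 1) ^ 2 * R ^ M * (2 * ‖(P (2 * 0 + c)).eval w‖ + 2 * ‖(P (2 * 1 + c)).eval w‖ / R + ‖(P (2 * 2 + c)).eval w‖ / R ^ 2)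
        ≤ ((M : ℝ) + 1) ^ 2 * R ^ M * Ku := mul_le_mul_of_nonneg_left hdata (by positivity)
      _ = Ku * ((M : ℝ) + 1) ^ 2 * R ^ M := by ring
  -- the `e`-part
  have hωn : ‖w * (z : ℂ)‖ = y * z := by rw [norm_mul, hwn, Complex.norm_real, Real.norm_of_nonneg hz.le]
  have hω : w * (z : ℂ) ≠ 0 := by
    intro h0; rw [h0, norm_zero] at hωn; linarith
  have heb : ‖(Q (2 * M + c)).eval w‖ ≤ Ke * ((M : ℝ) + 1) ^ 2 * R ^ M := by
    have h := norm_le_of_rec_eight_sq_complex (e := fun n => (Q n).eval w) hω He (2 * M + c)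
    rw [hωn, ← hΘe, ← hη] at h
    have hsum : ∑ j ∈ Finset.range 4, (‖(Q j).eval w‖ + ‖(Q (j + 4)).eval w‖ / (y * z)) / η ^ j
        ≤ ∑ j ∈ Finset.range 4, (Be + Be / (y * z)) / η ^ j := by
      refine Finset.sum_le_sum fun j hj => ?_
      have hj4 : j < 4 := Finset.mem_range.1 hj
      have hej : ‖(Q j).eval w‖ ≤ Be := hBe j (Finset.mem_range.2 (by omega)) w hwle
      have hej4 : ‖(Q (j + 4)).eval w‖ ≤ Be := hBe (j + 4) (Finset.mem_range.2 (by omega)) w hwle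
      exact div_le_div_of_nonneg_right (add_le_add hej (div_le_div_of_nonneg_right hej4 hyz0.le)) (pow_nonneg hη0.le _)
    have hpow : η ^ (2 * M + c) = η ^ c * Θe ^ M := by rw [pow_add, pow_mul, hη2, mul_comm]
    have hcnt : ((2 * M + c : ℕ) : ℝ) + 1 ≤ ((c : ℝ) + 2) * ((M : ℝ) + 1) := by
      push_cast; nlinarith only [Nat.cast_nonneg (α := ℝ) M, Nat.cast_nonneg (α := ℝ) c]
    have hsum0 : 0 ≤ ∑ j ∈ Finset.range 4, (‖(Q j).eval w‖ + ‖(Q (j + 4)).eval w‖ / (y * z)) / η ^ j :=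
      Finset.sum_nonneg fun j _ => div_nonneg (add_nonneg (norm_nonneg _) (div_nonneg (norm_nonneg _) hyz0.le)) (pow_nonneg hη0.le _)
    have hΘeM : Θe ^ M ≤ R ^ M := pow_le_pow_left₀ hΘe0.le hΘeR M
    calc ‖(Q (2 * M + c)).eval w‖
        ≤ (((2 * M + c : ℕ) : ℝ) + 1) * η ^ (2 * M + c) * ∑ j ∈ Finset.range 4, (‖(Q j).eval w‖ + ‖(Q (j + 4)).eval w‖ / (y * z)) / η ^ j := h
      _ ≤ (((c : ℝ) + 2) * ((M : ℝ) + 1)) * (η ^ c * R ^ M) * ∑ j ∈ Finset.range 4, (Be + Be / (y * z)) / η ^ j := by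
          rw [hpow]
          have hm0 : 0 ≤ η ^ c * Θe ^ M := by positivity
          refine mul_le_mul (mul_le_mul hcnt (mul_le_mul_of_nonneg_left hΘeM (pow_nonneg hη0.le _)) hm0 (by positivity)) hsum hsum0
            (by positivity)
      _ = Ke * ((M : ℝ) + 1) * R ^ M := by rw [hKe]; ring
      _ ≤ Ke * ((M : ℝ) + 1) ^ 2 * R ^ M := by
          have h1 : ((M : ℝ) + 1) ≤ ((M : ℝ) + 1) ^ 2 := by nlinarith only [Nat.cast_nonneg (α := ℝ) M]
          have h0 : 0 ≤ Ke * R ^ M := by positivity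
          have := mul_le_mul_of_nonneg_left h1 h0
          linarith only [this]
  -- assembly
  rcases Nat.eq_zero_or_pos M with hM | hM
  · -- M = 0: the trivial bound through `C_{1,c}(y,z)`
    subst hM
    simp only [Nat.mul_zero, pow_zero, mul_one, Nat.cast_zero, zero_add, one_pow]
    have h1 : ‖stripZ₂C 1 c w (z : ℂ)‖ ≤ stripZ₂ 1 c y z := by
      have := norm_stripZ₂C_le 1 c w (z : ℂ)
      rwa [hwn, Complex.norm_real, Real.norm_of_nonneg hz.le] at this
    have h2 : ‖((w - z) ^ 2 + 2 * w + 2 * z + 1) ^ 2‖ ≤ BΔ := by rw [← hPΔe]; exact hBΔ w hwle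
    rw [norm_mul]
    calc ‖((w - z) ^ 2 + 2 * w + 2 * z + 1) ^ 2‖ * ‖stripZ₂C 1 c w (z : ℂ)‖ ≤ BΔ * stripZ₂ 1 c y z :=
          mul_le_mul h2 h1 (norm_nonneg _) hBΔ0
      _ ≤ K := by rw [hK]; linarith only [hKu0, hKe0]
  · obtain ⟨M', rfl⟩ : ∃ M', M = M' + 1 := ⟨M - 1, by omega⟩
    have hdec := Hdec (2 * M' + c)
    rw [show 2 * M' + c + 2 = 2 * (M' + 1) + c by ring] at hdec
    rw [hdec]
    refine (norm_add_le _ _).trans ?_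
    have h1 := hub
    have h2 := heb
    have hKK : Ku + Ke ≤ K := by
      rw [hK]; have := mul_nonneg hBΔ0 (stripZ₂_pos 1 c hy hz).le; linarith only [this]
    have hpos : 0 ≤ (((M' + 1 : ℕ) : ℝ) + 1) ^ 2 * R ^ (M' + 1) := by positivity
    calc ‖(P (2 * (M' + 1) + c)).eval w‖ + ‖(Q (2 * (M' + 1) + c)).eval w‖
        ≤ Ku * (((M' + 1 : ℕ) : ℝ) + 1) ^ 2 * R ^ (M' + 1) + Ke * (((M' + 1 : ℕ) : ℝ) + 1) ^ 2 * R ^ (M' + 1) := add_le_add h1 h2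
      _ = (Ku + Ke) * ((((M' + 1 : ℕ) : ℝ) + 1) ^ 2 * R ^ (M' + 1)) := by ring
      _ ≤ K * ((((M' + 1 : ℕ) : ℝ) + 1) ^ 2 * R ^ (M' + 1)) := mul_le_mul_of_nonneg_right hKK hpos
      _ = K * (((M' + 1 : ℕ) : ℝ) + 1) ^ 2 * R ^ (M' + 1) := by ring

/-- ★★ **Uniform exponential decay on the arc `cos u ≤ cos δ`.**  For `0 < δ` there are `K ≥ 0` and `ρ < s` with
`‖Δ(ye^{iu})·C_{1,2M+c}(ye^{iu}, z)‖ ≤ K(M+1)²ρ^M` for every `u` with `cos u ≤ cos δ` and every `M` (`ρ = max(s − c₀(1 − cos δ)², √(yz))`).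
[cite: Durrett2019, §3.5 Theorem 3.5.2 (lane statement); Stanley2012EC1, §4.1 Theorem 4.1.1 (iii)] -/
theorem exists_norm_mul_stripZ₂C_le_of_cos_le (hy : 0 < y) (hz : 0 < z) (c : ℕ) {δ : ℝ} (hδ : Real.cos δ < 1) :
    ∃ K ρ : ℝ, 0 ≤ K ∧ 0 ≤ ρ ∧ ρ < stripMuY₂ 1 y z ^ 2 ∧ ∀ u : ℝ, Real.cos u ≤ Real.cos δ → ∀ M : ℕ,
      ‖(((y : ℂ) * cexp ((u : ℂ) * I) - z) ^ 2 + 2 * ((y : ℂ) * cexp ((u : ℂ) * I)) + 2 * z + 1) ^ 2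
          * stripZ₂C 1 (2 * M + c) ((y : ℂ) * cexp ((u : ℂ) * I)) (z : ℂ)‖ ≤ K * ((M : ℝ) + 1) ^ 2 * ρ ^ M := by
  obtain ⟨c₀, K, hc₀, hK0, H⟩ := exists_norm_mul_stripZ₂C_le_offaxis hy hz c
  obtain ⟨hys, hzs⟩ := lt_stripMuY₂_one_sq₂ hy hz
  set s := stripMuY₂ 1 y z ^ 2 with hs
  have hs0 : 0 < s := hy.trans hys
  have hΘes : Real.sqrt (y * z) < s := by
    rw [Real.sqrt_lt' hs0]; nlinarith
  set ρ := max (s - c₀ * (1 - Real.cos δ) ^ 2) (Real.sqrt (y * z)) with hρ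
  have hgapδ : s - c₀ * (1 - Real.cos δ) ^ 2 < s := by
    have h1 : 0 < 1 - Real.cos δ := by linarith
    have h2 : 0 < c₀ * (1 - Real.cos δ) ^ 2 := by positivity
    linarith
  refine ⟨K, ρ, hK0, le_trans (Real.sqrt_nonneg _) (le_max_right _ _), max_lt hgapδ hΘes,
    fun u hu M => (H u M).trans ?_⟩
  have hmono : max (s - c₀ * (1 - Real.cos u) ^ 2) (Real.sqrt (y * z)) ≤ ρ := by
    refine max_le_max ?_ le_rfl
    have h1 : (1 - Real.cos δ) ^ 2 ≤ (1 - Real.cos u) ^ 2 :=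
      pow_le_pow_left₀ (by linarith [Real.cos_le_one δ]) (by linarith) 2
    nlinarith [hc₀]
  have h0 : 0 ≤ max (s - c₀ * (1 - Real.cos u) ^ 2) (Real.sqrt (y * z)) := le_trans (Real.sqrt_nonneg _) (le_max_right _ _)
  exact mul_le_mul_of_nonneg_left (pow_le_pow_left₀ h0 hmono M) (by positivity)

/-- **The partial-fraction denominator on the circle `‖w‖ = y`**: `‖(w − z)² + 2w + 2z + 1‖ ≥ (y − z − 1)²`, hence
`‖Δ(w)‖ = ‖((w − z)² + 2w + 2z + 1)²‖ ≥ (y − z − 1)⁴` — the quadratic factors as `(w − w₊)(w − w₋)` with `w± = (z − 1) ± 2i√z`, `‖w±‖ = z + 1`.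
(So `Δ` vanishes on the circle only when `y = z + 1`.) [cite: Stanley2012EC1, §4.1 Theorem 4.1.1 (iii) (lane plumbing: the resultant of the partial fraction)] -/
theorem norm_twoWallDelta_ge (hz : 0 < z) {w : ℂ} {y : ℝ} (hw : ‖w‖ = y) :
    (y - z - 1) ^ 4 ≤ ‖((w - z) ^ 2 + 2 * w + 2 * z + 1) ^ 2‖ := by
  set r : ℂ := ((Real.sqrt z : ℝ) : ℂ) with hr
  have hr2 : r ^ 2 = (z : ℂ) := by rw [hr]; exact_mod_cast Real.sq_sqrt hz.le
  set w₁ : ℂ := ((z : ℂ) - 1) + 2 * r * I with hw₁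
  set w₂ : ℂ := ((z : ℂ) - 1) - 2 * r * I with hw₂
  have hfac : (w - z) ^ 2 + 2 * w + 2 * z + 1 = (w - w₁) * (w - w₂) := by
    rw [hw₁, hw₂]; ring_nf; rw [Complex.I_sq, hr2]; ring
  have hnorm : ∀ ε : ℝ, ε = 1 ∨ ε = -1 → ‖((z : ℂ) - 1) + ε * (2 * r * I)‖ = z + 1 := by
    intro ε hε
    have hsq : ‖((z : ℂ) - 1) + ε * (2 * r * I)‖ ^ 2 = (z + 1) ^ 2 := by
      rw [Complex.sq_norm, Complex.normSq_apply]
      have hre : (((z : ℂ) - 1) + ε * (2 * r * I)).re = z - 1 := by simp [hr]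
      have him : (((z : ℂ) - 1) + ε * (2 * r * I)).im = ε * (2 * Real.sqrt z) := by simp [hr]
      rw [hre, him]
      have hε2 : ε ^ 2 = 1 := by rcases hε with h | h <;> rw [h] <;> norm_num
      nlinarith [Real.sq_sqrt hz.le, hε2]
    have h0 : 0 ≤ ‖((z : ℂ) - 1) + ε * (2 * r * I)‖ := norm_nonneg _
    nlinarith [hsq, h0, hz]
  have hn₁ : ‖w₁‖ = z + 1 := by
    have := hnorm 1 (Or.inl rfl); rw [hw₁]; simpa using this
  have hn₂ : ‖w₂‖ = z + 1 := by
    have := hnorm (-1) (Or.inr rfl); rw [hw₂]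
    have e : ((z : ℂ) - 1) - 2 * r * I = ((z : ℂ) - 1) + ((-1 : ℝ) : ℂ) * (2 * r * I) := by push_cast; ring
    rw [e]; exact this
  have h1 : |y - (z + 1)| ≤ ‖w - w₁‖ := by
    have := abs_norm_sub_norm_le w w₁; rw [hw, hn₁] at this; exact this
  have h2 : |y - (z + 1)| ≤ ‖w - w₂‖ := by
    have := abs_norm_sub_norm_le w w₂; rw [hw, hn₂] at this; exact this
  rw [norm_pow, hfac, norm_mul]
  have h3 : (y - z - 1) ^ 2 ≤ ‖w - w₁‖ * ‖w - w₂‖ := by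
    have e : (y - z - 1) ^ 2 = |y - (z + 1)| * |y - (z + 1)| := by rw [← sq, sq_abs]; ring
    rw [e]
    exact mul_le_mul h1 h2 (abs_nonneg _) (norm_nonneg _)
  calc (y - z - 1) ^ 4 = ((y - z - 1) ^ 2) ^ 2 := by ring
    _ ≤ (‖w - w₁‖ * ‖w - w₂‖) ^ 2 := pow_le_pow_left₀ (sq_nonneg _) h3 2

/-- ★★ **Exponential decay of the partition function itself off the real axis, for `y ≠ z + 1`**: with `0 < δ`, `cos δ < 1`, there are `K ≥ 0` and
`ρ < s = μ₁(y,z)²` such that `‖C_{1,2M+c}(ye^{iu}, z)‖ ≤ K(M+1)²ρ^M` for every `u` with `cos u ≤ cos δ` and every `M`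
(`exists_norm_mul_stripZ₂C_le_of_cos_le` divided by `‖Δ‖ ≥ (y − z − 1)⁴ > 0`).  Since `C_{1,2M+c}(y,z) ≥ μ₁^{2M+c}/(K(y)K(z))`, the characteristic
function of the contact number at frequency `u` is `O((M+1)²(ρ/s)^M)` there — the aperiodicity input of the local limit theorem.
[cite: Durrett2019, §3.5 Theorem 3.5.2 (lane statement); Stanley2012EC1, §4.1 Theorem 4.1.1 (iii)] -/
theorem exists_norm_stripZ₂C_le_of_cos_le (hy : 0 < y) (hz : 0 < z) (hyz : y ≠ z + 1) (c : ℕ) {δ : ℝ} (hδ : Real.cos δ < 1) :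
    ∃ K ρ : ℝ, 0 ≤ K ∧ 0 ≤ ρ ∧ ρ < stripMuY₂ 1 y z ^ 2 ∧ ∀ u : ℝ, Real.cos u ≤ Real.cos δ → ∀ M : ℕ,
      ‖stripZ₂C 1 (2 * M + c) ((y : ℂ) * cexp ((u : ℂ) * I)) (z : ℂ)‖ ≤ K * ((M : ℝ) + 1) ^ 2 * ρ ^ M := by
  obtain ⟨K, ρ, hK0, hρ0, hρs, H⟩ := exists_norm_mul_stripZ₂C_le_of_cos_le hy hz c hδ
  have hd0 : 0 < (y - z - 1) ^ 4 := by
    have : y - z - 1 ≠ 0 := fun h => hyz (by linarith)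
    positivity
  refine ⟨K / (y - z - 1) ^ 4, ρ, by positivity, hρ0, hρs, fun u hu M => ?_⟩
  have h := H u hu M
  obtain ⟨hwn, -⟩ := norm_ofReal_mul_cexp_sub_le y u
  rw [abs_of_pos hy] at hwn
  have hΔ := norm_twoWallDelta_ge (z := z) hz hwn
  rw [norm_mul] at h
  rw [div_mul_eq_mul_div, div_mul_eq_mul_div, le_div_iff₀ hd0]
  calc ‖stripZ₂C 1 (2 * M + c) ((y : ℂ) * cexp ((u : ℂ) * I)) (z : ℂ)‖ * (y - z - 1) ^ 4
      ≤ ‖stripZ₂C 1 (2 * M + c) ((y : ℂ) * cexp ((u : ℂ) * I)) (z : ℂ)‖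
          * ‖(((y : ℂ) * cexp ((u : ℂ) * I) - z) ^ 2 + 2 * ((y : ℂ) * cexp ((u : ℂ) * I)) + 2 * z + 1) ^ 2‖ :=
        mul_le_mul_of_nonneg_left hΔ (norm_nonneg _)
    _ = ‖(((y : ℂ) * cexp ((u : ℂ) * I) - z) ^ 2 + 2 * ((y : ℂ) * cexp ((u : ℂ) * I)) + 2 * z + 1) ^ 2‖
          * ‖stripZ₂C 1 (2 * M + c) ((y : ℂ) * cexp ((u : ℂ) * I)) (z : ℂ)‖ := mul_comm _ _
    _ ≤ K * ((M : ℝ) + 1) ^ 2 * ρ ^ M := h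

end WidthOneYZ

end Literature.Probability.RandomPlanarGeometry.SAW.HexBW

end
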